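import Literature.AlgebraicGeometry.Resolution.AlterationsFormalNodesRegular
import Literature.AlgebraicGeometry.Resolution.PowerSeriesRegularLocal
import Mathlib.RingTheory.Ideal.KrullsHeightTheorem
import Mathlib.RingTheory.Ideal.Height
import HarnessLib

/-!
# The singular locus of the formal node ring `k⟦u, v, T₁, …, T_m⟧/(uv - ∏ Tᵢ^{νᵢ})`

Topic: `Literature/AlgebraicGeometry/Resolution`. Pure algebra underneath de Jong 1996, 3.5:

> "Looking at the equations `Q - t₁^{n₁} ⋯ t_r^{n_r}` for a point `x ∈ Sing(X)` as in 3.3, we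
> see that we must have `nᵢ ∈ {0, 1}`. Thus `B` looks like `A'⟦u, v⟧/(Q - t₁ ⋯ t_s)` … (In the
> equations above `X` is singular along `u = v = tᵢ = tⱼ = 0`.)" (p. 64)

For the formal node ring `M = DeJong1996.FormalNodeRing k m ν = C/(g)`,
`C = k⟦u, v, T₁, …, T_m⟧`, `g = uv - ∏ Tᵢ^{νᵢ}` (`AlterationsFormalNodes.lean`), all PROVED on
top of `PowerSeriesRegularLocal.lean` (regularity of `C`, the partial derivatives `∂/∂Xᵢ`, the
Jacobian necessary condition) and `RsopMonomialIdeals.lean` (ideals generated by some of the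
variables):

* `FormalNodeRing.singPrime a b` — the ideal `(u, v, T_a, T_b)` of `M` for `a ≠ b` with
  `ν_a, ν_b ≥ 1`: it is prime, `M_{(u, v, T_a, T_b)}` is NOT regular (`g` lies in the square of
  `(u, v, T_a, T_b)`: "`X` is singular along `u = v = tᵢ = tⱼ = 0`"), and
  `M/(u, v, T_a, T_b) ≅ C/(u, v, T_a, T_b)` is a regular local ring of dimension `m - 2` whose
  maximal ideal is generated by the classes of the `Tⱼ`;
* `FormalNodeRing.exists_singPrime_le_of_not_isRegularLocalRing` — **the Jacobian analysis**:
  if all `νᵢ ≤ 1` and `M_𝔔` is not regular for a prime `𝔔`, then `𝔔 ⊇ (u, v, T_a, T_b)` for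
  some `a ≠ b` with `ν_a = ν_b = 1` (`∂g/∂u = v`, `∂g/∂v = u`, `∂g/∂Tᵢ = -∏_{j ≠ i} Tⱼ` lie in
  `𝔔`); so the singular locus of `M` is exactly the union of the `V(u, v, T_a, T_b)`;
* `FormalNodeRing.triplePrime i` — the ideal `(u, v, Tᵢ)` of `M` for `νᵢ ≥ 2`: it is prime,
  `M_{(u, v, Tᵢ)}` is not regular, and `dim M_{(u, v, Tᵢ)} ≤ 2` (Krull's height theorem) — the
  codimension-2 singular locus which the first sentence of 3.5 excludes under
  `codim(Sing(X), X) ≥ 3`.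

## Sources

* A. J. de Jong, *Smoothness, semi-stability and alterations*, Publ. Math. IHÉS 83 (1996), 3.3–3.5
  (pp. 63–64). [DeJong1996]
* H. Matsumura, *Commutative Ring Theory* (1986), Thm. 14.2; The Stacks Project, Tag 07PF (via
  `PowerSeriesRegularLocal.lean`).
-/

noncomputable section

namespace Literature.AlgebraicGeometry.Resolution

universe u v

open IsLocalRing MvPowerSeries

/-! ## Ideals of `k⟦X⟧` generated by some of the variables -/

/-- Distinct variables of `k⟦Xᵢ : i ∈ σ⟧` (`σ` finite) form part of a regular system of
parameters. [cite: Matsumura1987, Thm. 14.2] -/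
theorem MvPowerSeries.isRsopPart_X_of_injective (k : Type u) [Field k] {σ : Type v} [Fintype σ]
    {c : ℕ} (w : Fin c → σ) (hw : Function.Injective w) :
    IsRsopPart (fun j => (MvPowerSeries.X (w j) : MvPowerSeries σ k)) := by
  let e := Fintype.equivFin σ
  have h := (isRsopPart_X k σ e.symm).comp (e ∘ w) (e.injective.comp hw)
  have heq : ((fun i => (MvPowerSeries.X (e.symm i) : MvPowerSeries σ k)) ∘ (e ∘ w)) =
      fun j => (MvPowerSeries.X (w j) : MvPowerSeries σ k) := by
    ext j : 1
    simp
  rwa [heq] at h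

namespace DeJong1996

namespace FormalNodeRing

variable (k : Type u) [Field k] (m : ℕ) (ν : Fin m → ℕ)

/-! ## The relation and its derivatives -/

/-- The monomial `∏ Tᵢ^{νᵢ}` is divisible by `T_a^{ν_a}`. [folklore] -/
theorem X_pow_dvd_prod (a : Fin m) :
    (MvPowerSeries.X (Sum.inr a) : MvPowerSeries (Fin 2 ⊕ Fin m) k) ^ (ν a) ∣
      ∏ i, (MvPowerSeries.X (Sum.inr i) : MvPowerSeries (Fin 2 ⊕ Fin m) k) ^ (ν i) :=
  Finset.dvd_prod_of_mem _ (Finset.mem_univ a)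

/-- If all `νᵢ ≤ 1`, the monomial `∏ Tᵢ^{νᵢ}` is the product of the `Tᵢ` with `νᵢ = 1`.
[folklore] -/
theorem prod_X_pow_eq_prod_filter (hν : ∀ i, ν i ≤ 1) :
    ∏ i, (MvPowerSeries.X (Sum.inr i) : MvPowerSeries (Fin 2 ⊕ Fin m) k) ^ (ν i) =
      ∏ i ∈ Finset.univ.filter (fun i => ν i = 1),
        (MvPowerSeries.X (Sum.inr i) : MvPowerSeries (Fin 2 ⊕ Fin m) k) := by
  classical
  rw [Finset.prod_filter]
  refine Finset.prod_congr rfl fun i _ => ?_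
  rcases Nat.le_one_iff_eq_zero_or_eq_one.mp (hν i) with h | h
  · rw [h, pow_zero, if_neg zero_ne_one]
  · rw [h, pow_one, if_pos rfl]

/-- `∂g/∂u = v` for `g = uv - ∏ Tᵢ^{νᵢ}`. [folklore] -/
theorem pderiv_inl_zero_formalNodeRelation :
    MvPowerSeries.pderiv (Sum.inl 0) (formalNodeRelation k m ν) =
      MvPowerSeries.X (Sum.inl 1) := by
  classical
  unfold formalNodeRelation
  rw [map_sub, Derivation.leibniz, smul_eq_mul, smul_eq_mul, MvPowerSeries.pderiv_X,
    MvPowerSeries.pderiv_X, if_neg (by simp), if_pos rfl, mul_zero, zero_add, mul_one,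
    Derivation.apply_prod_eq_zero, sub_zero]
  intro j _
  rw [Derivation.leibniz_pow, MvPowerSeries.pderiv_X, if_neg Sum.inr_ne_inl, smul_zero, smul_zero]

/-- `∂g/∂v = u` for `g = uv - ∏ Tᵢ^{νᵢ}`. [folklore] -/
theorem pderiv_inl_one_formalNodeRelation :
    MvPowerSeries.pderiv (Sum.inl 1) (formalNodeRelation k m ν) =
      MvPowerSeries.X (Sum.inl 0) := by
  classical
  unfold formalNodeRelation
  rw [map_sub, Derivation.leibniz, smul_eq_mul, smul_eq_mul, MvPowerSeries.pderiv_X,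
    MvPowerSeries.pderiv_X, if_pos rfl, if_neg (by simp), mul_one, mul_zero, add_zero,
    Derivation.apply_prod_eq_zero, sub_zero]
  intro j _
  rw [Derivation.leibniz_pow, MvPowerSeries.pderiv_X, if_neg Sum.inr_ne_inl, smul_zero, smul_zero]

/-- `∂g/∂Tᵢ = -∏_{j ≠ i, νⱼ = 1} Tⱼ` for `g = uv - ∏_{νⱼ = 1} Tⱼ` (all `νⱼ ≤ 1`) and `νᵢ = 1`.
[folklore] -/
theorem pderiv_inr_formalNodeRelation (hν : ∀ i, ν i ≤ 1) {i : Fin m} (hi : ν i = 1) :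
    MvPowerSeries.pderiv (Sum.inr i) (formalNodeRelation k m ν) =
      -∏ j ∈ (Finset.univ.filter (fun j => ν j = 1)).erase i,
        (MvPowerSeries.X (Sum.inr j) : MvPowerSeries (Fin 2 ⊕ Fin m) k) := by
  classical
  unfold formalNodeRelation
  rw [map_sub, Derivation.leibniz, smul_eq_mul, smul_eq_mul, MvPowerSeries.pderiv_X,
    MvPowerSeries.pderiv_X, if_neg Sum.inl_ne_inr, if_neg Sum.inl_ne_inr, mul_zero, mul_zero,
    add_zero, zero_sub, prod_X_pow_eq_prod_filter k m ν hν,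
    MvPowerSeries.pderiv_prod_X _ Sum.inr (Sum.inr_injective.injOn) (by simpa using hi)]

/-- The relation is not a unit as soon as some `νᵢ ≠ 0`. [folklore] -/
theorem span_formalNodeRelation_ne_top (hν : ∃ i, ν i ≠ 0) :
    Ideal.span {formalNodeRelation k m ν} ≠ ⊤ := by
  rw [Ne, Ideal.span_singleton_eq_top, ← mem_nonunits_iff, ← mem_maximalIdeal]
  exact (formalNodeRelation_mem_maximalIdeal_iff k m ν).mpr hν

/-- Primes of `M` are proper, so some `νᵢ ≠ 0` as soon as `M` has a prime ideal. [folklore] -/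
theorem exists_ne_zero_of_isPrime (P : Ideal (FormalNodeRing k m ν)) [hP : P.IsPrime] :
    ∃ i, ν i ≠ 0 := by
  by_contra h
  push Not at h
  have hunit : IsUnit (formalNodeRelation k m ν) := by
    rw [MvPowerSeries.isUnit_iff_constantCoeff, constantCoeff_formalNodeRelation, if_pos h]
    exact isUnit_one.neg
  have htop : Ideal.span {formalNodeRelation k m ν} = ⊤ := Ideal.span_singleton_eq_top.mpr hunit
  haveI : Subsingleton (FormalNodeRing k m ν) := Ideal.Quotient.subsingleton_iff.mpr htop
  exact hP.ne_top (Subsingleton.elim _ _)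

/-! ## Ideals of `M` generated by some of the variables -/

/-- The ideal of `M = k⟦u, v, T⟧/(g)` generated by the classes of the variables `X_{w 0}, …`.
[folklore] -/
def varIdeal {c : ℕ} (w : Fin c → Fin 2 ⊕ Fin m) : Ideal (FormalNodeRing k m ν) :=
  (Ideal.span (Set.range fun j => (MvPowerSeries.X (w j) : MvPowerSeries (Fin 2 ⊕ Fin m) k))).map
    (Ideal.Quotient.mk _)

/-- The four variables `u, v, T_a, T_b`. [folklore] -/
def quadVars {m : ℕ} (a b : Fin m) : Fin 4 → Fin 2 ⊕ Fin m :=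
  ![Sum.inl 0, Sum.inl 1, Sum.inr a, Sum.inr b]


/-- The ideal `(u, v, T_a, T_b)` of `M = k⟦u, v, T⟧/(uv - ∏ Tᵢ^{νᵢ})` (de Jong 1996, 3.5: "`X` is
singular along `u = v = tᵢ = tⱼ = 0`"). [cite: DeJong1996, 3.5, p. 64] -/
abbrev singPrime (a b : Fin m) : Ideal (FormalNodeRing k m ν) :=
  varIdeal k m ν (quadVars a b)


/-- `u ∈ (u, v, T_a, T_b)` etc.: membership of the four generators. [folklore] -/
theorem range_X_quadVars (a b : Fin m) :
    Set.range (fun j => (MvPowerSeries.X (quadVars a b j) : MvPowerSeries (Fin 2 ⊕ Fin m) k)) =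
      {MvPowerSeries.X (Sum.inl 0), MvPowerSeries.X (Sum.inl 1), MvPowerSeries.X (Sum.inr a),
        MvPowerSeries.X (Sum.inr b)} := by
  ext φ
  simp only [quadVars, Set.mem_range, Set.mem_insert_iff, Set.mem_singleton_iff]
  constructor
  · rintro ⟨j, rfl⟩
    fin_cases j <;> simp
  · rintro (rfl | rfl | rfl | rfl)
    · exact ⟨0, by simp⟩
    · exact ⟨1, by simp⟩
    · exact ⟨2, by simp⟩
    · exact ⟨3, by simp⟩


/-- The three variables `u, v, Tᵢ`. [folklore] -/
def tripleVars {m : ℕ} (i : Fin m) : Fin 3 → Fin 2 ⊕ Fin m :=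
  ![Sum.inl 0, Sum.inl 1, Sum.inr i]


/-- The ideal `(u, v, Tᵢ)` of `M`: for `νᵢ ≥ 2` the total space is singular along the
codimension-2 locus `u = v = tᵢ = 0` (de Jong 1996, 3.4; excluded in 3.5 by
`codim(Sing(X), X) ≥ 3`). [cite: DeJong1996, 3.4–3.5, pp. 63–64] -/
abbrev triplePrime (i : Fin m) : Ideal (FormalNodeRing k m ν) :=
  varIdeal k m ν (tripleVars i)


variable {m ν}

/-- If the relation lies in `(X_{w j})`, the preimage of `varIdeal w` in `k⟦u, v, T⟧` is
`(X_{w j})`. [folklore] -/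
theorem comap_varIdeal {c : ℕ} (w : Fin c → Fin 2 ⊕ Fin m)
    (hg : formalNodeRelation k m ν ∈
      Ideal.span (Set.range fun j => (MvPowerSeries.X (w j) : MvPowerSeries (Fin 2 ⊕ Fin m) k))) :
    (varIdeal k m ν w).comap (Ideal.Quotient.mk _) =
      Ideal.span (Set.range fun j => (MvPowerSeries.X (w j) : MvPowerSeries (Fin 2 ⊕ Fin m) k)) := by
  rw [varIdeal, Ideal.comap_map_of_surjective _ Ideal.Quotient.mk_surjective,
    ← RingHom.ker_eq_comap_bot, Ideal.mk_ker, sup_eq_left]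
  exact (Ideal.span_singleton_le_iff_mem _).mpr hg

/-- `varIdeal w` is prime when the `w j` are distinct and the relation lies in `(X_{w j})`.
[cite: Matsumura1987, Thm. 14.3] -/
theorem isPrime_varIdeal {c : ℕ} (w : Fin c → Fin 2 ⊕ Fin m) (hw : Function.Injective w)
    (hg : formalNodeRelation k m ν ∈
      Ideal.span (Set.range fun j => (MvPowerSeries.X (w j) : MvPowerSeries (Fin 2 ⊕ Fin m) k))) :
    (varIdeal k m ν w).IsPrime := by
  haveI := (MvPowerSeries.isRsopPart_X_of_injective k w hw).isPrime_span_range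
  exact Ideal.map_isPrime_of_surjective Ideal.Quotient.mk_surjective
    (by rw [Ideal.mk_ker]; exact (Ideal.span_singleton_le_iff_mem _).mpr hg)

/-- The classes of the `X_{w j}` lie in `varIdeal w`. [folklore] -/
theorem mk_X_mem_varIdeal {c : ℕ} (w : Fin c → Fin 2 ⊕ Fin m) (j : Fin c) :
    Ideal.Quotient.mk (Ideal.span {formalNodeRelation k m ν}) (MvPowerSeries.X (w j)) ∈
      varIdeal k m ν w :=
  Ideal.mem_map_of_mem _ (Ideal.subset_span ⟨j, rfl⟩)

/-- `varIdeal w ≤ P` as soon as `P` contains the classes of the `X_{w j}`. [folklore] -/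
theorem varIdeal_le_of_forall_mem {c : ℕ} (w : Fin c → Fin 2 ⊕ Fin m)
    {P : Ideal (FormalNodeRing k m ν)}
    (h : ∀ j, Ideal.Quotient.mk (Ideal.span {formalNodeRelation k m ν})
      (MvPowerSeries.X (w j)) ∈ P) :
    varIdeal k m ν w ≤ P := by
  rw [varIdeal, Ideal.map_le_iff_le_comap, Ideal.span_le]
  rintro _ ⟨j, rfl⟩
  exact h j

/-- **`M/(X_{w j}) ≅ k⟦u, v, T⟧/(X_{w j})`** when the relation lies in `(X_{w j})`.
[folklore] -/
def quotientVarIdealEquiv {c : ℕ} (w : Fin c → Fin 2 ⊕ Fin m)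
    (hg : formalNodeRelation k m ν ∈
      Ideal.span (Set.range fun j => (MvPowerSeries.X (w j) : MvPowerSeries (Fin 2 ⊕ Fin m) k))) :
    (FormalNodeRing k m ν ⧸ varIdeal k m ν w) ≃+*
      MvPowerSeries (Fin 2 ⊕ Fin m) k ⧸
        Ideal.span (Set.range fun j => (MvPowerSeries.X (w j) : MvPowerSeries (Fin 2 ⊕ Fin m) k)) :=
  DoubleQuot.quotQuotEquivQuotOfLE ((Ideal.span_singleton_le_iff_mem _).mpr hg)

/-- `M/(X_{w j})` is a regular local ring of dimension `m + 2 - c` when the `c` variables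
`X_{w j}` are distinct and the relation lies in `(X_{w j})`. [cite: Matsumura1987, Thm. 14.2] -/
theorem isRegularLocalRing_quotient_varIdeal {c : ℕ} (w : Fin c → Fin 2 ⊕ Fin m)
    (hw : Function.Injective w)
    (hg : formalNodeRelation k m ν ∈
      Ideal.span (Set.range fun j => (MvPowerSeries.X (w j) : MvPowerSeries (Fin 2 ⊕ Fin m) k))) :
    IsRegularLocalRing (FormalNodeRing k m ν ⧸ varIdeal k m ν w) ∧
      ringKrullDim (FormalNodeRing k m ν ⧸ varIdeal k m ν w) + c = (m + 2 : ℕ) := by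
  have hz := MvPowerSeries.isRsopPart_X_of_injective k w hw
  haveI := hz.isRegularLocalRing_quotient
  refine ⟨IsRegularLocalRing.of_ringEquiv (quotientVarIdealEquiv k w hg).symm, ?_⟩
  rw [ringKrullDim_eq_of_ringEquiv (quotientVarIdealEquiv k w hg), hz.ringKrullDim_quotient_add,
    ringKrullDim_mvPowerSeries, Nat.card_sum, Nat.card_fin, Nat.card_fin, add_comm]

/-- `M_{(X_{w j})}` is NOT regular when the relation lies in `(X_{w j})²` (and some `νᵢ ≠ 0`):
"`X` is singular along `u = v = tᵢ = tⱼ = 0`". [cite: DeJong1996, 3.5, p. 64] -/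
theorem not_isRegularLocalRing_localization_varIdeal {c : ℕ} (w : Fin c → Fin 2 ⊕ Fin m)
    (hw : Function.Injective w)
    (hg2 : formalNodeRelation k m ν ∈
      Ideal.span (Set.range fun j =>
        (MvPowerSeries.X (w j) : MvPowerSeries (Fin 2 ⊕ Fin m) k)) ^ 2) :
    haveI := isPrime_varIdeal k w hw (Ideal.pow_le_self two_ne_zero hg2)
    ¬ IsRegularLocalRing (Localization.AtPrime (varIdeal k m ν w)) := by
  haveI := isPrime_varIdeal k w hw (Ideal.pow_le_self two_ne_zero hg2)
  haveI : IsDomain (MvPowerSeries (Fin 2 ⊕ Fin m) k) := NoZeroDivisors.to_isDomain _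
  haveI : IsRegularRing (MvPowerSeries (Fin 2 ⊕ Fin m) k) := isRegularRing_mvPowerSeries k _
  refine not_isRegularLocalRing_localization_quotient_of_mem_sq
    (formalNodeRelation_ne_zero k m ν) (varIdeal k m ν w) ?_
  rw [comap_varIdeal k w (Ideal.pow_le_self two_ne_zero hg2)]
  exact hg2

/-! ## `(u, v, T_a, T_b)`: the singular primes -/

/-- The four variables `u, v, T_a, T_b` are distinct for `a ≠ b`. [folklore] -/
theorem quadVars_injective {a b : Fin m} (hab : a ≠ b) : Function.Injective (quadVars a b) := by
  intro i j h
  fin_cases i <;> fin_cases j <;> simp_all [quadVars]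

/-- The relation lies in `(u, v, T_a, T_b)²` when `ν_a, ν_b ≥ 1` and `a ≠ b`: `uv ∈ (u)(v)` and
`T_a T_b ∣ ∏ Tᵢ^{νᵢ}`. [folklore] -/
theorem formalNodeRelation_mem_sq_quad {a b : Fin m} (hab : a ≠ b) (ha : ν a ≠ 0)
    (hb : ν b ≠ 0) :
    formalNodeRelation k m ν ∈
      Ideal.span (Set.range fun j =>
        (MvPowerSeries.X (quadVars a b j) : MvPowerSeries (Fin 2 ⊕ Fin m) k)) ^ 2 := by
  classical
  set I := Ideal.span (Set.range fun j =>
    (MvPowerSeries.X (quadVars a b j) : MvPowerSeries (Fin 2 ⊕ Fin m) k)) with hI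
  have hu : (MvPowerSeries.X (Sum.inl 0) : MvPowerSeries (Fin 2 ⊕ Fin m) k) ∈ I :=
    Ideal.subset_span ⟨0, by simp [quadVars]⟩
  have hv : (MvPowerSeries.X (Sum.inl 1) : MvPowerSeries (Fin 2 ⊕ Fin m) k) ∈ I :=
    Ideal.subset_span ⟨1, by simp [quadVars]⟩
  have hTa : (MvPowerSeries.X (Sum.inr a) : MvPowerSeries (Fin 2 ⊕ Fin m) k) ∈ I :=
    Ideal.subset_span ⟨2, by simp [quadVars]⟩
  have hTb : (MvPowerSeries.X (Sum.inr b) : MvPowerSeries (Fin 2 ⊕ Fin m) k) ∈ I :=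
    Ideal.subset_span ⟨3, by simp [quadVars]⟩
  unfold formalNodeRelation
  rw [pow_two]
  refine Ideal.sub_mem _ (Ideal.mul_mem_mul hu hv) ?_
  -- `T_a^{ν_a} T_b^{ν_b}` divides the monomial
  have hsub : ({a, b} : Finset (Fin m)) ⊆ Finset.univ := Finset.subset_univ _
  rw [← Finset.prod_sdiff hsub, Finset.prod_pair hab]
  refine Ideal.mul_mem_left _ _ (Ideal.mul_mem_mul ?_ ?_)
  · obtain ⟨n, hn⟩ := Nat.exists_eq_succ_of_ne_zero ha
    rw [hn, pow_succ]
    exact Ideal.mul_mem_left _ _ hTa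
  · obtain ⟨n, hn⟩ := Nat.exists_eq_succ_of_ne_zero hb
    rw [hn, pow_succ]
    exact Ideal.mul_mem_left _ _ hTb

/-- The relation lies in `(u, v, T_a, T_b)`. [folklore] -/
theorem formalNodeRelation_mem_quad {a b : Fin m} (hab : a ≠ b) (ha : ν a ≠ 0) (hb : ν b ≠ 0) :
    formalNodeRelation k m ν ∈
      Ideal.span (Set.range fun j =>
        (MvPowerSeries.X (quadVars a b j) : MvPowerSeries (Fin 2 ⊕ Fin m) k)) :=
  Ideal.pow_le_self two_ne_zero (formalNodeRelation_mem_sq_quad k hab ha hb)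

/-- `(u, v, T_a, T_b)` is a prime ideal of `M`. [cite: DeJong1996, 3.5, p. 64] -/
theorem isPrime_singPrime {a b : Fin m} (hab : a ≠ b) (ha : ν a ≠ 0) (hb : ν b ≠ 0) :
    (singPrime k m ν a b).IsPrime :=
  isPrime_varIdeal k _ (quadVars_injective hab) (formalNodeRelation_mem_quad k hab ha hb)

/-- **`M` is singular along `u = v = T_a = T_b = 0`**: `M_{(u, v, T_a, T_b)}` is not a regular
local ring. [cite: DeJong1996, 3.5, p. 64] -/
theorem not_isRegularLocalRing_localization_singPrime {a b : Fin m} (hab : a ≠ b) (ha : ν a ≠ 0)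
    (hb : ν b ≠ 0) :
    haveI := isPrime_singPrime k hab ha hb
    ¬ IsRegularLocalRing (Localization.AtPrime (singPrime k m ν a b)) :=
  not_isRegularLocalRing_localization_varIdeal k _ (quadVars_injective hab)
    (formalNodeRelation_mem_sq_quad k hab ha hb)

/-- `M/(u, v, T_a, T_b)` is a regular local ring of dimension `m - 2`.
[cite: DeJong1996, 3.5, p. 64] -/
theorem isRegularLocalRing_quotient_singPrime {a b : Fin m} (hab : a ≠ b) (ha : ν a ≠ 0)
    (hb : ν b ≠ 0) :
    IsRegularLocalRing (FormalNodeRing k m ν ⧸ singPrime k m ν a b) ∧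
      ringKrullDim (FormalNodeRing k m ν ⧸ singPrime k m ν a b) + 4 = (m + 2 : ℕ) :=
  isRegularLocalRing_quotient_varIdeal k _ (quadVars_injective hab)
    (formalNodeRelation_mem_quad k hab ha hb)

/-- The generators `u, v, T_a, T_b` lie in `singPrime a b`. [folklore] -/
theorem mk_X_mem_singPrime (a b : Fin m) :
    Ideal.Quotient.mk (Ideal.span {formalNodeRelation k m ν}) (MvPowerSeries.X (Sum.inl 0)) ∈
        singPrime k m ν a b ∧
      Ideal.Quotient.mk (Ideal.span {formalNodeRelation k m ν}) (MvPowerSeries.X (Sum.inl 1)) ∈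
        singPrime k m ν a b ∧
      Ideal.Quotient.mk (Ideal.span {formalNodeRelation k m ν}) (MvPowerSeries.X (Sum.inr a)) ∈
        singPrime k m ν a b ∧
      Ideal.Quotient.mk (Ideal.span {formalNodeRelation k m ν}) (MvPowerSeries.X (Sum.inr b)) ∈
        singPrime k m ν a b :=
  ⟨mk_X_mem_varIdeal k (quadVars a b) 0, mk_X_mem_varIdeal k (quadVars a b) 1,
    mk_X_mem_varIdeal k (quadVars a b) 2, mk_X_mem_varIdeal k (quadVars a b) 3⟩

/-- The image of the maximal ideal of `M` in `M/(u, v, T_a, T_b)` (which is the maximal ideal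
of the quotient) is generated by the classes of the `Tⱼ` (`u, v ↦ 0`). [folklore] -/
theorem map_maximalIdeal_quotient_singPrime_le {a b : Fin m} (ha : ν a ≠ 0) :
    haveI := FormalNodeRing.isLocalRing k m (ν := ν) ⟨a, ha⟩
    (maximalIdeal (FormalNodeRing k m ν)).map (Ideal.Quotient.mk (singPrime k m ν a b)) ≤
      Ideal.span (Set.range fun j : Fin m => Ideal.Quotient.mk (singPrime k m ν a b)
        (Ideal.Quotient.mk (Ideal.span {formalNodeRelation k m ν})
          (MvPowerSeries.X (Sum.inr j)))) := by
  have hν : ∃ i, ν i ≠ 0 := ⟨a, ha⟩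
  haveI := FormalNodeRing.isLocalRing k m hν
  rw [FormalNodeRing.maximalIdeal_eq_span k m hν, Ideal.map_span, Ideal.span_le]
  rintro _ ⟨_, ⟨j, rfl⟩, rfl⟩
  rcases j with j | j
  · -- `u, v ↦ 0`
    have h0 : Ideal.Quotient.mk (singPrime k m ν a b)
        (Ideal.Quotient.mk (Ideal.span {formalNodeRelation k m ν}) (MvPowerSeries.X (Sum.inl j))) =
          0 := by
      rw [Ideal.Quotient.eq_zero_iff_mem]
      fin_cases j
      · exact (mk_X_mem_singPrime k (ν := ν) a b).1
      · exact (mk_X_mem_singPrime k (ν := ν) a b).2.1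
    rw [SetLike.mem_coe, h0]
    exact Ideal.zero_mem _
  · exact Ideal.subset_span ⟨j, rfl⟩

/-- **The Jacobian analysis of 3.5: every singular prime of `M = k⟦u, v, T⟧/(uv - ∏_{νᵢ=1} Tᵢ)`
contains some `(u, v, T_a, T_b)`.** If all `νᵢ ≤ 1` and `M_𝔔` is not a regular local ring for a
prime `𝔔` of `M`, then `u, v, T_a, T_b ∈ 𝔔` for some `a ≠ b` with `ν_a = ν_b = 1`: the partial
derivatives `∂g/∂u = v`, `∂g/∂v = u`, `∂g/∂Tᵢ = -∏_{j ≠ i} Tⱼ` of the relation lie in the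
preimage of `𝔔` (Jacobian necessary condition), and a prime containing `∏_{j ≠ i} Tⱼ` contains
some `Tⱼ`, `j ≠ i` — twice. [cite: DeJong1996, 3.5, p. 64] -/
theorem exists_singPrime_le_of_not_isRegularLocalRing (hν : ∀ i, ν i ≤ 1)
    (P : Ideal (FormalNodeRing k m ν)) [P.IsPrime]
    (hP : ¬ IsRegularLocalRing (Localization.AtPrime P)) :
    ∃ a b : Fin m, a ≠ b ∧ ν a = 1 ∧ ν b = 1 ∧ singPrime k m ν a b ≤ P := by
  classical
  haveI : IsRegularRing (MvPowerSeries (Fin 2 ⊕ Fin m) k) := isRegularRing_mvPowerSeries k _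
  set Q : Ideal (MvPowerSeries (Fin 2 ⊕ Fin m) k) :=
    P.comap (Ideal.Quotient.mk (Ideal.span {formalNodeRelation k m ν})) with hQ
  haveI : Q.IsPrime := Ideal.comap_isPrime _ P
  have hD : ∀ j, MvPowerSeries.pderiv j (formalNodeRelation k m ν) ∈ Q := fun j =>
    Derivation.apply_mem_comap_of_not_isRegularLocalRing _ _ P hP
  -- `u, v ∈ Q`
  have hv : (MvPowerSeries.X (Sum.inl 1) : MvPowerSeries (Fin 2 ⊕ Fin m) k) ∈ Q := by
    have h := hD (Sum.inl 0)
    rwa [pderiv_inl_zero_formalNodeRelation] at h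
  have hu : (MvPowerSeries.X (Sum.inl 0) : MvPowerSeries (Fin 2 ⊕ Fin m) k) ∈ Q := by
    have h := hD (Sum.inl 1)
    rwa [pderiv_inl_one_formalNodeRelation] at h
  -- from `Tᵢ` with `νᵢ = 1` to another `Tⱼ ∈ Q`, `j ≠ i`, `νⱼ = 1`
  set S := Finset.univ.filter (fun j : Fin m => ν j = 1) with hS
  have step : ∀ i ∈ S, ∃ j ∈ S, j ≠ i ∧
      (MvPowerSeries.X (Sum.inr j) : MvPowerSeries (Fin 2 ⊕ Fin m) k) ∈ Q := by
    intro i hi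
    have hi1 : ν i = 1 := (Finset.mem_filter.mp hi).2
    have h := hD (Sum.inr i)
    rw [pderiv_inr_formalNodeRelation k m ν hν hi1, Ideal.neg_mem_iff,
      Ideal.IsPrime.prod_mem_iff] at h
    obtain ⟨j, hj, hjQ⟩ := h
    exact ⟨j, Finset.mem_of_mem_erase hj, (Finset.mem_erase.mp hj).1, hjQ⟩
  -- `S` is nonempty: some `νᵢ ≠ 0`, hence `= 1`
  obtain ⟨i₀, hi₀⟩ := exists_ne_zero_of_isPrime k m ν P
  have hi₀S : i₀ ∈ S := by
    rw [hS, Finset.mem_filter]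
    refine ⟨Finset.mem_univ _, ?_⟩
    rcases Nat.le_one_iff_eq_zero_or_eq_one.mp (hν i₀) with h | h
    · exact (hi₀ h).elim
    · exact h
  obtain ⟨a, haS, -, haQ⟩ := step i₀ hi₀S
  obtain ⟨b, hbS, hba, hbQ⟩ := step a haS
  have ha1 : ν a = 1 := (Finset.mem_filter.mp haS).2
  have hb1 : ν b = 1 := (Finset.mem_filter.mp hbS).2
  refine ⟨a, b, hba.symm, ha1, hb1, varIdeal_le_of_forall_mem k _ fun j => ?_⟩
  change MvPowerSeries.X (quadVars a b j) ∈ Q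
  fin_cases j
  · exact hu
  · exact hv
  · exact haQ
  · exact hbQ

/-! ## `(u, v, Tᵢ)` for `νᵢ ≥ 2`: the codimension-2 singular primes -/

/-- The three variables `u, v, Tᵢ` are distinct. [folklore] -/
theorem tripleVars_injective (i : Fin m) : Function.Injective (tripleVars i) := by
  intro a b h
  fin_cases a <;> fin_cases b <;> simp_all [tripleVars]

/-- For `νᵢ ≥ 2` the relation lies in `(u, v, Tᵢ)²`. [folklore] -/
theorem formalNodeRelation_mem_sq_triple {i : Fin m} (hi : 2 ≤ ν i) :
    formalNodeRelation k m ν ∈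
      Ideal.span (Set.range fun j =>
        (MvPowerSeries.X (tripleVars i j) : MvPowerSeries (Fin 2 ⊕ Fin m) k)) ^ 2 := by
  classical
  set I := Ideal.span (Set.range fun j =>
    (MvPowerSeries.X (tripleVars i j) : MvPowerSeries (Fin 2 ⊕ Fin m) k)) with hI
  have hu : (MvPowerSeries.X (Sum.inl 0) : MvPowerSeries (Fin 2 ⊕ Fin m) k) ∈ I :=
    Ideal.subset_span ⟨0, by simp [tripleVars]⟩
  have hv : (MvPowerSeries.X (Sum.inl 1) : MvPowerSeries (Fin 2 ⊕ Fin m) k) ∈ I :=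
    Ideal.subset_span ⟨1, by simp [tripleVars]⟩
  have hT : (MvPowerSeries.X (Sum.inr i) : MvPowerSeries (Fin 2 ⊕ Fin m) k) ∈ I :=
    Ideal.subset_span ⟨2, by simp [tripleVars]⟩
  unfold formalNodeRelation
  rw [pow_two]
  refine Ideal.sub_mem _ (Ideal.mul_mem_mul hu hv) ?_
  obtain ⟨q, hq⟩ := X_pow_dvd_prod k m ν i
  rw [hq]
  refine Ideal.mul_mem_right _ _ ?_
  obtain ⟨n, hn⟩ := Nat.exists_eq_add_of_le hi
  rw [hn, pow_add, pow_two]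
  exact Ideal.mul_mem_right _ _ (Ideal.mul_mem_mul hT hT)

/-- `(u, v, Tᵢ)` is a prime ideal of `M` (for `νᵢ ≥ 2`). [cite: DeJong1996, 3.4, p. 63] -/
theorem isPrime_triplePrime {i : Fin m} (hi : 2 ≤ ν i) : (triplePrime k m ν i).IsPrime :=
  isPrime_varIdeal k _ (tripleVars_injective i)
    (Ideal.pow_le_self two_ne_zero (formalNodeRelation_mem_sq_triple k hi))

/-- For `νᵢ ≥ 2`, `M_{(u, v, Tᵢ)}` is not a regular local ring. [cite: DeJong1996, 3.4–3.5, pp. 63–64] -/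
theorem not_isRegularLocalRing_localization_triplePrime {i : Fin m} (hi : 2 ≤ ν i) :
    haveI := isPrime_triplePrime k hi
    ¬ IsRegularLocalRing (Localization.AtPrime (triplePrime k m ν i)) :=
  not_isRegularLocalRing_localization_varIdeal k _ (tripleVars_injective i)
    (formalNodeRelation_mem_sq_triple k hi)

/-- The generators `u, v, Tᵢ` lie in `triplePrime i`. [folklore] -/
theorem mk_X_mem_triplePrime (i : Fin m) :
    Ideal.Quotient.mk (Ideal.span {formalNodeRelation k m ν}) (MvPowerSeries.X (Sum.inl 0)) ∈
        triplePrime k m ν i ∧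
      Ideal.Quotient.mk (Ideal.span {formalNodeRelation k m ν}) (MvPowerSeries.X (Sum.inl 1)) ∈
        triplePrime k m ν i ∧
      Ideal.Quotient.mk (Ideal.span {formalNodeRelation k m ν}) (MvPowerSeries.X (Sum.inr i)) ∈
        triplePrime k m ν i :=
  ⟨mk_X_mem_varIdeal k (tripleVars i) 0, mk_X_mem_varIdeal k (tripleVars i) 1,
    mk_X_mem_varIdeal k (tripleVars i) 2⟩

/-- **For `νᵢ ≥ 2`, `dim M_{(u, v, Tᵢ)} ≤ 2`**: `M_{(u, v, Tᵢ)} = C_𝔔/(g)` for the prime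
`𝔔 = (u, v, Tᵢ)` of `C = k⟦u, v, T⟧`, of height `≤ 3` (Krull's height theorem), and `g ≠ 0`.
[cite: DeJong1996, 3.4–3.5, pp. 63–64] -/
theorem ringKrullDim_localization_triplePrime_le {i : Fin m} (hi : 2 ≤ ν i) :
    haveI := isPrime_triplePrime k hi
    ringKrullDim (Localization.AtPrime (triplePrime k m ν i)) ≤ 2 := by
  classical
  haveI := isPrime_triplePrime k hi
  haveI : IsNoetherianRing (MvPowerSeries (Fin 2 ⊕ Fin m) k) :=
    isNoetherianRing_mvPowerSeries k (Fin 2 ⊕ Fin m)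
  set g := formalNodeRelation k m ν with hgdef
  set Q : Ideal (MvPowerSeries (Fin 2 ⊕ Fin m) k) :=
    (triplePrime k m ν i).comap (Ideal.Quotient.mk (Ideal.span {g})) with hQ
  haveI hQp : Q.IsPrime := Ideal.comap_isPrime _ _
  have hQeq : Q = Ideal.span (Set.range fun j =>
      (MvPowerSeries.X (tripleVars i j) : MvPowerSeries (Fin 2 ⊕ Fin m) k)) :=
    comap_varIdeal k _ (Ideal.pow_le_self two_ne_zero (formalNodeRelation_mem_sq_triple k hi))
  have hgQ : g ∈ Q := mem_comap_mk_span_singleton g _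
  -- `ht Q ≤ 3`
  have hht : Q.height ≤ ((3 : ℕ) : ℕ∞) := by
    refine (Ideal.height_le_spanFinrank Q hQp.ne_top).trans ?_
    set F : Fin 3 → MvPowerSeries (Fin 2 ⊕ Fin m) k := fun j => MvPowerSeries.X (tripleVars i j)
      with hF
    have h1 : (Ideal.span (Set.range F)).spanFinrank ≤ (Set.range F).ncard :=
      Submodule.spanFinrank_span_le_ncard_of_finite (Set.finite_range F)
    have h2 : (Set.range F).ncard ≤ 3 := by
      have hr : Set.range F = ((Finset.univ : Finset (Fin 3)).image F : Set _) := by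
        rw [Finset.coe_image, Finset.coe_univ, Set.image_univ]
      rw [hr, Set.ncard_coe_finset]
      exact Finset.card_image_le.trans (by rw [Finset.card_univ, Fintype.card_fin])
    rw [hQeq]
    exact_mod_cast h1.trans h2
  -- `M_𝔓 ≅ C_Q/(g)`
  have e := localizationQuotientEquiv g (triplePrime k m ν i)
  rw [ringKrullDim_eq_of_ringEquiv e]
  set CQ := Localization.AtPrime Q with hCQ
  haveI : IsRegularRing (MvPowerSeries (Fin 2 ⊕ Fin m) k) := isRegularRing_mvPowerSeries k _
  haveI : IsRegularLocalRing CQ := IsRegularRing.isRegularLocalRing_localization Q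
  haveI : IsDomain CQ := isDomain_of_isRegularLocalRing CQ
  have hg0 : algebraMap (MvPowerSeries (Fin 2 ⊕ Fin m) k) CQ g ≠ 0 := by
    intro h0
    apply formalNodeRelation_ne_zero k m ν
    have hinj : Function.Injective (algebraMap (MvPowerSeries (Fin 2 ⊕ Fin m) k) CQ) :=
      IsLocalization.injective CQ (Ideal.primeCompl_le_nonZeroDivisors Q)
    rw [← map_zero (algebraMap (MvPowerSeries (Fin 2 ⊕ Fin m) k) CQ)] at h0
    exact hinj h0
  have hgm : algebraMap (MvPowerSeries (Fin 2 ⊕ Fin m) k) CQ g ∈ maximalIdeal CQ := by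
    rw [← Localization.AtPrime.map_eq_maximalIdeal]
    exact Ideal.mem_map_of_mem _ hgQ
  have hdim := ringKrullDim_quotient_span_singleton_succ_eq_ringKrullDim_of_mem_nonZeroDivisors
    (mem_nonZeroDivisors_of_ne_zero hg0) hgm
  have hCQdim : ringKrullDim CQ ≤ ((2 : ℕ) : WithBot ℕ∞) + 1 := by
    rw [IsLocalization.AtPrime.ringKrullDim_eq_height Q CQ]
    have h3 : ((2 : ℕ) : WithBot ℕ∞) + 1 = (((3 : ℕ) : ℕ∞) : WithBot ℕ∞) := by norm_cast
    rw [h3]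
    exact WithBot.coe_le_coe.mpr hht
  rw [← hdim] at hCQdim
  exact ENat.WithBot.add_le_add_one_right_iff.mp hCQdim

end FormalNodeRing

end DeJong1996

end Literature.AlgebraicGeometry.Resolution

end
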